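import Mathlib.RingTheory.AlgebraicIndependent.Basic
import Literature.NumberTheory.DiophantineGeometry.BertiniSeparabilityProofs
import Literature.NumberTheory.DiophantineGeometry.BertiniDirectionProofs
import Literature.NumberTheory.DiophantineGeometry.BertiniHomogenizationProofs
import Literature.RingTheory.MvPolynomial.KaltofenNoetherFormsProofs
import HarnessLib

/-!
# Towards Kaltofen's Theorem 7 (effective Noether forms): proofs, part 4 — Lemma 3
# (the generic discriminant of an absolutely irreducible polynomial does not vanish)

Sibling proof file of `KaltofenNoetherForms.lean` (E. Kaltofen, *Effective Noether
irreducibility forms and applications*, J. Comput. System Sci. 50 (1995) 274–295).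

Kaltofen's **Lemma 3** (§4, p. 18): for `f` of degree `d` and the generic substitution
`ψ = f(x + v₁, wᵢx + vᵢ)/l`, "if `r := Res_x(ψ(x, 0, …, 0), ∂ψ(x, 0, …, 0)/∂x) = 0`, then `f`
factors over `K̄`". We prove the contrapositive for the substitution `xᵢ ↦ μᵢ + vᵢ x` of the
tree's Bertini files, with GENERIC (indeterminate) `μ, v`, in the form consumed by the assembly
of Theorem 7 (the set `S₂` of coefficients of the generic resultant `ρ̄`):

* `resultant_genericLine_derivative_ne_zero` — if `f ∈ K[x₁, …, xₙ]` is absolutely irreducible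
  of degree `δ`, then for `g = f(μ + xv) ∈ K[z, μ, v][x]` (all `3n` parameters indeterminates)
  the Sylvester resultant `Res_x^{δ, δ-1}(g, ∂g/∂x)` is a NONZERO polynomial in the parameters.

Proof: map `K[z, μ, v] → Ω[Z]` (`Ω` an algebraically closed field containing `K(v)`, `μ ↦ Z`,
`v ↦ v`, `z ↦ 0`); the image of the resultant is the discriminant `Res_T(G, ∂G/∂T)` of
`G = f(Z + Tv)`, which is nonzero by the tree's `resultant_lineRestrict_derivative_ne_zero`
(Cafure–Matera's form of Kaltofen's Lemma 4) because `f` stays irreducible over `Ω`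
(`IsAbsIrreducible.irreducible_map`), `f_δ(v) ≠ 0` and `D_v f ≠ 0` for the generic direction
`v` (`exists_pderiv_ne_zero`: an absolutely irreducible polynomial has a nonzero partial
derivative). No definitions, no named facts.

## References

* E. Kaltofen, J. Comput. System Sci. 50 (1995) 274–295, §4 Lemma 3, Lemma 4. [Kaltofen1995]
* A. Cafure, G. Matera, Finite Fields Appl. 12 (2006) 155–185, §3.2. [CafureMatera2006]
-/

noncomputable section

open MvPolynomial
open scoped Polynomial

universe u v

namespace Literature.RingTheory.MvPolynomial

open Literature.NumberTheory.DiophantineGeometry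

variable {K : Type u} [Field K] {n : ℕ}

/-! ### Generic points do not kill nonzero polynomials -/

/-- At an algebraically independent point a nonzero polynomial does not vanish. [folklore] -/
theorem aeval_ne_zero_of_algebraicIndependent {Ω : Type*} [CommRing Ω] [Algebra K Ω] {ι : Type*}
    {v : ι → Ω} (hv : AlgebraicIndependent K v) {p : MvPolynomial ι K} (hp : p ≠ 0) :
    MvPolynomial.aeval v p ≠ 0 :=
  fun h => hp (hv (by rw [h, map_zero]))

/-- **The generic directional derivative is nonzero:** if some `∂ᵢ f ≠ 0` and `v` is
algebraically independent over `K`, then `D_v f = Σ vᵢ ∂ᵢ f ≠ 0`. [folklore] -/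
theorem sum_C_mul_pderiv_map_ne_zero {Ω : Type*} [Field Ω] [Algebra K Ω] {v : Fin n → Ω}
    (hv : AlgebraicIndependent K v) {f : MvPolynomial (Fin n) K} (hf : ∃ i, pderiv i f ≠ 0) :
    (∑ i, C (v i) * pderiv i (MvPolynomial.map (algebraMap K Ω) f)) ≠ 0 := by
  classical
  obtain ⟨i₀, hi₀⟩ := hf
  obtain ⟨m, hm⟩ : ∃ m, coeff m (pderiv i₀ f) ≠ 0 := by
    by_contra h
    push Not at h
    exact hi₀ (MvPolynomial.ext _ _ fun m => by rw [h m, coeff_zero])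
  intro hsum
  have hcoeff := congrArg (coeff m) hsum
  rw [coeff_sum, coeff_zero] at hcoeff
  simp only [coeff_C_mul, pderiv_map, coeff_map] at hcoeff
  -- the linear form `L = Σᵢ (coeff m ∂ᵢf) vᵢ`
  set L : MvPolynomial (Fin n) K := ∑ i, C (coeff m (pderiv i f)) * X i with hL_def
  have hL : MvPolynomial.aeval v L = 0 := by
    rw [hL_def, map_sum]
    simp only [map_mul, MvPolynomial.aeval_C, MvPolynomial.aeval_X]
    rw [← hcoeff]
    exact Finset.sum_congr rfl fun i _ => mul_comm _ _
  refine aeval_ne_zero_of_algebraicIndependent hv ?_ hL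
  intro hL0
  have h1 := congrArg (coeff (Finsupp.single i₀ 1)) hL0
  rw [hL_def, coeff_sum, coeff_zero, Finset.sum_eq_single i₀] at h1
  · rw [coeff_C_mul, coeff_X, if_pos rfl, mul_one] at h1
    exact hm h1
  · intro j _ hj
    rw [coeff_C_mul, coeff_X, if_neg, mul_zero]
    simp [Finsupp.single_eq_single_iff, hj]
  · intro h
    exact absurd (Finset.mem_univ i₀) h

/-- An absolutely irreducible polynomial has a nonzero partial derivative (it does over `K̄`,
`exists_pderiv_ne_zero`). [folklore] -/
theorem _root_.Literature.NumberTheory.DiophantineGeometry.IsAbsIrreducible.exists_pderiv_ne_zero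
    {f : MvPolynomial (Fin n) K} (hf : IsAbsIrreducible f) : ∃ i, pderiv i f ≠ 0 := by
  obtain ⟨i, hi⟩ := Literature.NumberTheory.DiophantineGeometry.exists_pderiv_ne_zero
    (E := AlgebraicClosure K) (hf : Irreducible _)
  refine ⟨i, fun h => hi ?_⟩
  rw [pderiv_map, h, map_zero]

/-! ### Lemma 3: the generic discriminant is a nonzero polynomial -/

/-- **Kaltofen's Lemma 3 (contrapositive, generic parameters).** Let `f ∈ K[x₁, …, xₙ]` be
absolutely irreducible of total degree `δ`, and let `g = f(μ + xv) ∈ K[z, μ, v][x]` be its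
restriction to the generic line (parameters: `z = inl`, `μ = inr inl`, `v = inr inr`, all
indeterminates). Then the Sylvester resultant `Res_x^{δ,δ-1}(g, ∂g/∂x) ∈ K[z, μ, v]` is not the
zero polynomial. [cite: Kaltofen1995, §4 Lemma 3] -/
theorem resultant_genericLine_derivative_ne_zero {f : MvPolynomial (Fin n) K}
    (hf : IsAbsIrreducible f) :
    Polynomial.resultant
      (MvPolynomial.aeval (fun i ↦ Polynomial.C (X (Sum.inr (Sum.inl i))) +
        Polynomial.C (X (Sum.inr (Sum.inr i))) * Polynomial.X :
          Fin n → Polynomial (MvPolynomial (Fin n ⊕ (Fin n ⊕ Fin n)) K)) f)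
      (Polynomial.derivative (MvPolynomial.aeval (fun i ↦ Polynomial.C (X (Sum.inr (Sum.inl i))) +
        Polynomial.C (X (Sum.inr (Sum.inr i))) * Polynomial.X :
          Fin n → Polynomial (MvPolynomial (Fin n ⊕ (Fin n ⊕ Fin n)) K)) f))
      f.totalDegree (f.totalDegree - 1) ≠ 0 := by
  classical
  set δ := f.totalDegree with hδ_def
  set g : Polynomial (MvPolynomial (Fin n ⊕ (Fin n ⊕ Fin n)) K) := MvPolynomial.aeval (fun i ↦ Polynomial.C (X (Sum.inr (Sum.inl i))) +
    Polynomial.C (X (Sum.inr (Sum.inr i))) * Polynomial.X :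
      Fin n → Polynomial (MvPolynomial (Fin n ⊕ (Fin n ⊕ Fin n)) K)) f with hg_def
  -- an algebraically closed field containing the generic direction `v`
  set Ω := AlgebraicClosure (FractionRing (MvPolynomial (Fin n) K)) with hΩ_def
  set v' : Fin n → Ω := fun i => algebraMap (MvPolynomial (Fin n) K) Ω (X i) with hv'_def
  have hinjΩ : Function.Injective (algebraMap (MvPolynomial (Fin n) K) Ω) := by
    rw [IsScalarTower.algebraMap_eq (MvPolynomial (Fin n) K) (FractionRing (MvPolynomial (Fin n) K)) Ω,
      RingHom.coe_comp]
    exact (algebraMap (FractionRing (MvPolynomial (Fin n) K)) Ω).injective.comp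
      (IsFractionRing.injective (MvPolynomial (Fin n) K) (FractionRing (MvPolynomial (Fin n) K)))
  have hv' : AlgebraicIndependent K v' := by
    change Function.Injective (MvPolynomial.aeval v')
    have h : (MvPolynomial.aeval v' : MvPolynomial (Fin n) K →ₐ[K] Ω) =
        IsScalarTower.toAlgHom K (MvPolynomial (Fin n) K) Ω := by
      rw [MvPolynomial.aeval_unique (IsScalarTower.toAlgHom K (MvPolynomial (Fin n) K) Ω)]
      rfl
    rw [h]
    exact hinjΩ
  -- `f` over `Ω` satisfies the hypotheses of the discriminant lemma
  set fΩ : MvPolynomial (Fin n) Ω := f.map (algebraMap K Ω) with hfΩ_def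
  have hfΩ : Irreducible fΩ := hf.irreducible_map _
  have hdegΩ : fΩ.totalDegree = δ := totalDegree_map_of_injective' f (algebraMap K Ω).injective
  have hf0 : f ≠ 0 := fun h => hfΩ.ne_zero (by rw [hfΩ_def, h, map_zero])
  have hvtop : MvPolynomial.eval v' (homogeneousComponent fΩ.totalDegree fΩ) ≠ 0 := by
    rw [hdegΩ, hfΩ_def, homogeneousComponent_map, eval_map, ← MvPolynomial.aeval_def]
    exact aeval_ne_zero_of_algebraicIndependent hv' (homogeneousComponent_totalDegree_ne_zero hf0)
  have hD : (∑ i, C (v' i) * pderiv i fΩ) ≠ 0 :=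
    sum_C_mul_pderiv_map_ne_zero hv' hf.exists_pderiv_ne_zero
  have hres := resultant_lineRestrict_derivative_ne_zero hfΩ hvtop hD
  rw [hdegΩ] at hres
  -- the specialisation `K[z, μ, v] → Ω[Z]`, `z ↦ 0`, `μ ↦ Z`, `v ↦ v'`
  set Θ : MvPolynomial (Fin n ⊕ (Fin n ⊕ Fin n)) K →ₐ[K] MvPolynomial (Fin n) Ω := MvPolynomial.aeval
    (Sum.elim (fun _ => (0 : MvPolynomial (Fin n) Ω))
      (Sum.elim (fun i => (X i : MvPolynomial (Fin n) Ω)) (fun i => C (v' i)))) with hΘ_def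
  have hΘμ : ∀ i, Θ (X (Sum.inr (Sum.inl i))) = X i := fun i => by simp [hΘ_def]
  have hΘv : ∀ i, Θ (X (Sum.inr (Sum.inr i))) = C (v' i) := fun i => by simp [hΘ_def]
  have hΘg : g.map (Θ : MvPolynomial (Fin n ⊕ (Fin n ⊕ Fin n)) K →+* MvPolynomial (Fin n) Ω) = MvPolynomial.aeval
      (fun i ↦ Polynomial.C (X i) + Polynomial.C (C (v' i)) * Polynomial.X :
        Fin n → Polynomial (MvPolynomial (Fin n) Ω)) fΩ := by
    have key : (Polynomial.mapRingHom (Θ : MvPolynomial (Fin n ⊕ (Fin n ⊕ Fin n)) K →+* MvPolynomial (Fin n) Ω)).comp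
        (MvPolynomial.aeval (fun i ↦ Polynomial.C (X (Sum.inr (Sum.inl i))) +
          Polynomial.C (X (Sum.inr (Sum.inr i))) * Polynomial.X :
            Fin n → Polynomial (MvPolynomial (Fin n ⊕ (Fin n ⊕ Fin n)) K))).toRingHom =
        (MvPolynomial.aeval (fun i ↦ Polynomial.C (X i) + Polynomial.C (C (v' i)) * Polynomial.X :
          Fin n → Polynomial (MvPolynomial (Fin n) Ω))).toRingHom.comp
          (MvPolynomial.map (algebraMap K Ω)) := by
      refine MvPolynomial.ringHom_ext (fun a ↦ ?_) (fun i ↦ ?_)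
      · simp only [RingHom.coe_comp, Function.comp_apply, AlgHom.toRingHom_eq_coe, RingHom.coe_coe,
          MvPolynomial.algHom_C, Polynomial.algebraMap_apply, Polynomial.coe_mapRingHom,
          Polynomial.map_C, MvPolynomial.map_C, MvPolynomial.algebraMap_eq,
          MvPolynomial.algebraMap_apply]
      · simp only [RingHom.coe_comp, Function.comp_apply, AlgHom.toRingHom_eq_coe, RingHom.coe_coe,
          MvPolynomial.aeval_X, Polynomial.coe_mapRingHom, Polynomial.map_add, Polynomial.map_mul,
          Polynomial.map_C, Polynomial.map_X, hΘμ, hΘv, MvPolynomial.map_X]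
    have := DFunLike.congr_fun key f
    simpa only [hg_def, hfΩ_def, RingHom.coe_comp, Function.comp_apply, Polynomial.coe_mapRingHom,
      AlgHom.toRingHom_eq_coe, RingHom.coe_coe] using this
  intro h0
  apply hres
  rw [← hΘg, Polynomial.derivative_map, Polynomial.resultant_map_map, h0, map_zero]

end Literature.RingTheory.MvPolynomial

end
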